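import Mathlib.RingTheory.MvPolynomial.Homogeneous
import Mathlib.Algebra.Order.Antidiag.Finsupp
import Mathlib.LinearAlgebra.Matrix.PosDef
import Mathlib.Analysis.Matrix.Spectrum
import Mathlib.Analysis.Convex.Hull
import Mathlib.LinearAlgebra.Matrix.Rank
import Mathlib.RingTheory.Nullstellensatz
import Mathlib.RingTheory.KrullDimension.Basic
import Mathlib.RingTheory.AlgebraicIndependent.Basic
import Mathlib.Analysis.Complex.Basic
import Literature.Computability.AlgebraicComplexity.DeterminantalComplexity
import Literature.Computability.AlgebraicComplexity.StandardFamilies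
import Literature.Computability.AlgebraicComplexity.HessianAtOrigin
import Literature.Computability.AlgebraicComplexity.HessianRank
import Literature.Computability.AlgebraicComplexity.OrbitCoordinateRing
import Literature.Analysis.Matrix.KyFanMaximumPrinciple
import HarnessLib

/-!
# Yabe 2015: the bi-polynomial rank (`brank`) and determinantal complexity

Typed literature (val-lit cell, seat t17, row `Yab15-A`): A. Yabe, *Bi-polynomial rank and
determinantal complexity*, arXiv:1504.00151 (2015), §§1–5 — every numbered statement of §§1–2 and
§4 that bears on the permanent-versus-determinant problem, typed AS PRINTED with a page/chunk
locator, plus the two lemmas of §5 that carry the proof of the main theorem. Honest framing: this is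
bookkeeping of a published argument; `VP ≠ VNP` is NOT proved and nothing here is progress on it.

**Source metadata caveat.** The held text `paper:arxiv-1504.00151` IS Yabe's paper (title line
"Bi-polynomial rank and determinantal complexity", abstract "… improved to `(d-1)^2 + 1` over the
field of reals"), but the literature store's title/doi metadata for that key is wrong (it shows
M. Kumar, *A quadratic lower bound for homogeneous algebraic branching programs*, CCC 2017,
doi:10.4230/LIPIcs.CCC.2017.19). Cite as `Yabe2015` = arXiv:1504.00151. Locators below are
`pNNNN` = 3000-character chunk files of `lit read paper:arxiv-1504.00151` (not PDF pages) together
with the printed theorem numbers.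

## The source in one paragraph

For a field `K`, `D` variables and a homogeneous `p` of even degree `2k`, the *bi-polynomial rank*
`brank(p)` is the least `n` with `p = Σ_{i<n} f_i g_i`, `f_i, g_i` homogeneous of degree `k`
(Def. 1.4). Main theorem (Thm. 1.5): for `x₀ ∈ Zeros(p)` and `1 ≤ k ≤ D`,
`dc(p) ≥ 2^{-(2k-2)} · brank((p_{x₀})^{(2k)}) − 2(k−1)·D^{k−1}`, where `p_{x₀}(x) = p(x + x₀)` and
`q^{(j)}` is the degree-`j` homogeneous part. For `k = 1` this contains the Mignon–Ressayre Hessian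
bound (§3.1) and gives, over `ℝ`, `dc(per_d) ≥ (d−1)² + 1` (Thm. 1.7, via the signature
`(2d−2, (d−1)²+1, 0)` of the Mignon–Ressayre Hessian and Lemma 3.1 `rank Q ≥ max(n₊, n₋)` for
`Q + Qᵀ` of signature `(n₊, n₋, n₀)`). §2: `brank` as rank minimisation over Gram matrices
(Thm. 2.1, Cors. 2.2–2.3), generic lower bound by a dimension count (Thm. 2.4, Prop. 2.5), the
trivial upper bound `brank ≤ s_k ≤ D^k` (Prop. 2.6), relation with ABP width (Prop. 2.7). §4: a
concave-minimisation certificate for lower bounds on the minimum rank over psd matrices (Lemma 4.1,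
Thm. 4.5; Prop. 1.8 is its `brank` form). §5: the normal form `p_{x₀} = det(A(x) + Λ_n^r)` at a zero
(Lemma 5.1) and the key estimate `brank(p_{A,2k,n−1}) ≤ n + 2(k−1)D^{k−1}` (Prop. 5.2).

## Contents (source item → declaration → status)

* Def. 1.4 (p0003) → `bRank k p` (a real `noncomputable def`, `sInf` over `ℕ`) — DEFINITION;
  API `bRank_le_of_eq_sum`; §2.1 index set `𝓘_k` → CITED, not re-declared: the tree's
  `degMonomials σ k` / `DegIdx σ k` / `mem_degMonomials_iff` / `formCoeff` (`OrbitCoordinateRing.lean`,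
  = Mathlib's `Finset.finsuppAntidiag univ k`); `v(x)ᵀ Q v(x)` → `gramPoly k Q`.
* Prop. 2.6 (p0006: `brank(p) ≤ s_k ≤ D^k`) → PROVED: `bRank_le_card_degMonomials`,
  `card_degMonomials_le_pow` (so the `sInf` defining `bRank` is never the junk value on homogeneous
  input of degree `2k`).
* Thm. 1.5 (p0003) → `yabe2015_thm_1_5` — FACT (R2-dischargeable: Lemma 5.1 + Prop. 5.2 +
  Lemma 5.3, pure linear algebra / Mahajan–Vinay clow sequences).
* Cor. 1.6 (p0003) → `yabe2015_cor_1_6` — FACT (the `Ω` bookkeeping from Thm. 1.5; stated with explicit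
  constants).
* Thm. 1.7 (p0003; proof §3.2 p0008–p0009) → `yabe2015_thm_1_7` — FACT. Numerical cross-check made
  while typing (exact rational arithmetic, this seat): the Hessian of `per_d` at `Σ_d` has inertia
  `(2d−2, (d−1)²+1, 0)` for `d = 3, 4, 5, 6`, as the printed proof claims.
* Prop. 1.8 (p0004) → `yabe2015_prop_1_8` — FACT (= Cor. 2.3 + Thm. 4.5).
* Thm. 2.1 (p0005) → `yabe2015_thm_2_1` — DISCHARGED below (`yabe2015_thm_2_1_holds`, via
  `exists_gramPoly_eq_of_eq_sum` / `exists_eq_sum_of_gramPoly_eq`: outer products of coefficient vectors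
  one way, a basis of the column space the other way).
* Cor. 2.2 (p0005) → `yabe2015_cor_2_2` — DISCHARGED below (`yabe2015_cor_2_2_holds`: symmetrise the
  optimal Gram matrix, `rank(Q'+Q'ᵀ) ≤ 2 rank Q'`). Cor. 2.3 (p0005) → `yabe2015_cor_2_3` — FACT (R2:
  spectral splitting `Q = Q₊ − Q₋`).
* §2.1 `𝒳_p` (p0005) → `gramPairSet k p`.
* Thm. 2.4 (p0005–p0006) → `yabe2015_thm_2_4` — FACT (dimension of determinantal varieties; R1-ish).
* Prop. 2.5 (p0006) → `yabe2015_prop_2_5` — FACT.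
* Prop. 2.7 (p0006), Lemma 2.8 (p0006) → `yabe2015_prop_2_7`, `yabe2015_lemma_2_8` — FACTS (R2).
* §3 `Σ_d` → CITED, not re-declared: the tree's `mrPoint K m` (`HessianAtOrigin.lean`) is the same
  matrix with the exceptional entry at `(0,0)` instead of `(d,d)` (a row/column permutation, which
  changes neither `per` nor the Hessian's rank/signature); Thm. 1.3 (Mignon–Ressayre) → CITED:
  `sq_le_two_mul_determinantalComplexity_perPoly_charZero_holds` (`MignonRessayreCharZero.lean`),
  `rank_mrHess` (`MignonRessayreBound.lean`).
* §3.1 (p0008, inside "An alternative proof of Theorem 1.3") → `yabe2015_rank_hessian_le_two_mul_bRank`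
  — FACT (the bridge `rank H_{p,x₀} ≤ 2·brank(p_{x₀}^{(2)})`, stated for characteristic `0`).
* Lemma 3.1 (p0008) → `yabe2015_lemma_3_1` — FACT (R2; dischargeable from the tree's Courant–Fischer
  counting form `Literature.Analysis.Matrix.EigenvalueCount.le_card_eigenvalues_gt`).
* §4.1: `μ_l` → `sumSmallestEig`, `minrank` → `minRank`; Lemma 4.1, Thm. 4.5 (p0010) →
  `yabe2015_lemma_4_1`, `yabe2015_thm_4_5` — FACTS (R2; Cor. 4.4, concavity of `μ_l`, is in tree in
  superadditive form: `Literature.Analysis.Matrix.KyFan.sum_eigenvalues₀_tail_add_ge`). Prop. 4.2 /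
  Cor. 4.3 (SDP duality for `μ_l`) and Cor. 4.6 are NOT typed (optimisation bookkeeping; Cor. 4.6 is
  Prop. 1.8 with Cor. 4.3 substituted). §4.2 (the explicit affine space `𝒵_{2k}`) is NOT typed.
* Lemma 5.1, Prop. 5.2 (p0011) → `lambdaDiag`, `yabe2015_lemma_5_1`, `yabe2015_prop_5_2` — FACTS (R2),
  typed because they ARE the architecture of the proof of Thm. 1.5 (a discharge follows them).
* NOT typed, by charter: Conj. 1.2 (`dc(per_d) = d^{ω(log d)}`, char `≠ 2`) is an OPEN CONJECTURE —
  conjectures live in Theses, not Literature (in tree it is the `DetQP` thesis / the open statement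
  `DcPerSuperpolynomial`); Defs. 2.9–2.11, Fact 2.10 (ABP width; Thm. 2.11 = Mahajan–Vinay) — the
  tree's ABP vocabulary lives elsewhere (`SymmetricDetRepresentationProofs.symOfABP`); §5.1 clow
  machinery.

## Conventions

* `dc = Literature.Computability.AlgebraicComplexity.determinantalComplexity` (an attained `sInf`,
  Valiant universality), `per_d = perPoly (Fin d) K : MvPolynomial (Fin d × Fin d) K`,
  `p_{x₀} = transl x₀ p` (`HessianAtOrigin.lean`), `q^{(j)} = MvPolynomial.homogeneousComponent j q`,
  `D = Fintype.card σ`, `Zeros(p) = {x | eval x p = 0}`, Hessian `hessianMatrix p x` (`HessianRank.lean`).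
* Inequalities with the printed rational constants are cleared of denominators and stated in `ℕ`
  (e.g. Thm. 1.5 as `brank ≤ 2^{2k−2}·(dc + 2(k−1)D^{k−1})`); every `ℕ` subtraction that occurs is
  protected by a printed hypothesis (`1 ≤ k`, `1 ≤ d`, `r ≤ s_k`) and flagged in the docstring.
* "Sym_n", "Psd_n" over `ℝ` are Mathlib's `Matrix.IsSymm` / `Matrix.PosSemidef`; `conv` is
  `convexHull ℝ`; the signature counts `n₊, n₋` of a real symmetric matrix are
  `#{i | 0 < λ_i}`, `#{i | λ_i < 0}` for Mathlib's `Matrix.IsHermitian.eigenvalues` (the convention of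
  `Literature/Analysis/Matrix/SylvesterInertiaCertificate.lean`).
* No `instance`, no `notation`, no attribute changes (typer lint rule).

## References

* [Yabe2015] A. Yabe, *Bi-polynomial rank and determinantal complexity*, arXiv:1504.00151 (2015).
* [MignonRessayre2004] T. Mignon, N. Ressayre, IMRN 2004:79, 4241–4253 (Thm. 1.3 of the source).
* [CaiChenLi2010] J.-Y. Cai, X. Chen, D. Li, comput. complex. 19 (2010) 37–56 (quoted in §1 of the
  source as "`dc(perm_d) ≥ (d−2)(d−3)/2` over any field of characteristic not equal to two"; see
  `CCL10HessianCharP.lean` for what that paper proves).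
-/

noncomputable section

open MvPolynomial Matrix Finset

namespace Literature.Computability.AlgebraicComplexity

universe u v

/-! ### §2.1 / Def. 1.4: monomials of fixed degree, the bi-polynomial rank, Gram matrices -/

section Defs

variable {K : Type u} [CommSemiring K] {σ : Type v}

/-- **Yabe 2015, Definition 1.4** (p0003, "The bi-polynomial rank `brank(p)` of `p ∈ K[x]^{(2k)}` is
defined as the minimum number `n` such that there exist `2n` polynomials `f_1,…,f_n, g_1,…,g_n ∈
K[x]^{(k)}` satisfying `p = Σ_{i=1}^n f_i g_i`"). Here `K[x]^{(k)}` = homogeneous of degree `k`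
(`MvPolynomial.IsHomogeneous · k`, which includes `0`). Defined for every `p` as an `sInf` over `ℕ`;
JUNK VALUE: if `p` is not homogeneous of degree `2k` the set is empty and `bRank k p = 0`; for `p`
homogeneous of degree `2k` the set is nonempty (`bRank_le_card_degMonomials`, Prop. 2.6), so no junk
intervenes. The parameter is the HALF-degree `k` (the source writes `brank(p)` for `p` of degree `2k`).
[cite: Yabe2015, Definition 1.4] -/
noncomputable def bRank (k : ℕ) (p : MvPolynomial σ K) : ℕ :=
  sInf {n : ℕ | ∃ f g : Fin n → MvPolynomial σ K,
    (∀ i, (f i).IsHomogeneous k) ∧ (∀ i, (g i).IsHomogeneous k) ∧ p = ∑ i, f i * g i}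

/-- A decomposition `p = Σ_{i ∈ ι} f_i g_i` into products of degree-`k` forms, indexed by any finite
type, bounds `brank(p) ≤ |ι|` (Yabe 2015, Def. 1.4, p0003; reindex along `ι ≃ Fin |ι|`).
[cite: Yabe2015, Definition 1.4] -/
theorem bRank_le_of_eq_sum {ι : Type*} [Fintype ι] {k : ℕ} {p : MvPolynomial σ K}
    (f g : ι → MvPolynomial σ K) (hf : ∀ i, (f i).IsHomogeneous k)
    (hg : ∀ i, (g i).IsHomogeneous k) (hp : p = ∑ i, f i * g i) :
    bRank k p ≤ Fintype.card ι := by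
  classical
  refine Nat.sInf_le ⟨f ∘ (Fintype.equivFin ι).symm, g ∘ (Fintype.equivFin ι).symm,
    fun i => hf _, fun i => hg _, ?_⟩
  rw [hp]
  exact Fintype.sum_equiv (Fintype.equivFin ι) _ _ fun i => by
    simp [Function.comp, Equiv.symm_apply_apply]

/-- The quadratic expression `v(x)ᵀ Q v(x) = Σ_{I,J ∈ 𝓘_k} Q_{I,J} x^{I+J}` of Yabe 2015, §2.1
(p0005: `v(x) := (x^I)_{I ∈ 𝓘_k}`, matrices `Q = (q_{I,J})_{I,J ∈ 𝓘_k}` of size `s_k`), for a matrix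
`Q` indexed by the degree-`k` monomials. [cite: Yabe2015, §2.1] -/
def gramPoly [Fintype σ] [DecidableEq σ] (k : ℕ) (Q : Matrix (DegIdx σ k) (DegIdx σ k) K) :
    MvPolynomial σ K :=
  ∑ I, ∑ J, monomial (I.1 + J.1) (Q I J)

end Defs

/-! ### Prop. 2.6: `brank(p) ≤ s_k ≤ D^k` (proved; non-vacuity of `bRank`) -/

section UpperBound

variable {K : Type u} [CommSemiring K] {σ : Type v}

/-- Every exponent vector of degree `≥ j` dominates one of degree exactly `j`. [folklore] -/
private theorem exists_le_degree_eq (m : σ →₀ ℕ) : ∀ j : ℕ, j ≤ m.degree → ∃ I : σ →₀ ℕ, I ≤ m ∧ I.degree = j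
  | 0, _ => ⟨0, bot_le, by simp⟩
  | j + 1, hj => by
      obtain ⟨I, hIm, hIj⟩ := exists_le_degree_eq m j (Nat.le_of_succ_le hj)
      have hne : I ≠ m := by rintro rfl; omega
      obtain ⟨s, hs⟩ : ∃ s, I s < m s := by
        by_contra h
        simp only [not_exists, not_lt] at h
        exact hne (le_antisymm hIm (Finsupp.le_def.2 h))
      refine ⟨I + Finsupp.single s 1, Finsupp.le_def.2 fun t => ?_, by simp [hIj]⟩
      by_cases hts : t = s
      · subst hts; simp; omega
      · have h0 : Finsupp.single s 1 t = 0 := Finsupp.single_eq_of_ne hts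
        simp only [Finsupp.add_apply, h0, add_zero]
        exact Finsupp.le_def.1 hIm t

/-- **Yabe 2015, Proposition 2.6, first inequality** (p0006: "For any polynomial `p ∈ K[x]^{(2k)}`, it
holds that `brank(p) ≤ s_k ≤ D^k`"): `brank(p) ≤ s_k = |𝓘_k|`. Proof: split each monomial `x^m` of `p`
(`|m| = 2k`) as `x^I · x^{m−I}` with `|I| = k` and group by `I`. In particular the `sInf` defining
`bRank k p` is attained for homogeneous `p` of degree `2k`. [cite: Yabe2015, Proposition 2.6] -/
theorem bRank_le_card_degMonomials [Fintype σ] [DecidableEq σ] {k : ℕ} {p : MvPolynomial σ K}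
    (hp : p.IsHomogeneous (2 * k)) : bRank k p ≤ (degMonomials σ k).card := by
  classical
  -- a degree-`k` half of every monomial of `p`
  have hdeg : ∀ m ∈ p.support, m.degree = 2 * k := fun m hm => by
    by_contra h
    exact (mem_support_iff.1 hm) (hp.coeff_eq_zero h)
  have hex : ∀ m : σ →₀ ℕ, ∃ I : σ →₀ ℕ, m ∈ p.support → I ≤ m ∧ I.degree = k := fun m => by
    by_cases hm : m ∈ p.support
    · obtain ⟨I, hI⟩ := exists_le_degree_eq m k (by rw [hdeg m hm]; omega)
      exact ⟨I, fun _ => hI⟩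
    · exact ⟨0, fun h => (hm h).elim⟩
  choose half hhalf using hex
  have hmaps : ∀ m ∈ p.support, half m ∈ degMonomials σ k := fun m hm =>
    mem_degMonomials_iff.2 (hhalf m hm).2
  set f : DegIdx σ k → MvPolynomial σ K := fun I => monomial I.1 1 with hf
  set g : DegIdx σ k → MvPolynomial σ K := fun I =>
    ∑ m ∈ p.support with half m = I.1, monomial (m - I.1) (coeff m p) with hg
  have hfg : p = ∑ I, f I * g I := by
    have h1 : ∀ I : DegIdx σ k, f I * g I =
        ∑ m ∈ p.support with half m = I.1, monomial m (coeff m p) := fun I => by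
      rw [hf, hg, Finset.mul_sum]
      refine Finset.sum_congr rfl fun m hm => ?_
      obtain ⟨hm, hI⟩ := Finset.mem_filter.1 hm
      rw [monomial_mul, one_mul, ← hI, add_tsub_cancel_of_le (hhalf m hm).1]
    calc p = ∑ m ∈ p.support, monomial m (coeff m p) := p.as_sum
      _ = ∑ I ∈ degMonomials σ k, ∑ m ∈ p.support with half m = I, monomial m (coeff m p) :=
          (Finset.sum_fiberwise_of_maps_to hmaps _).symm
      _ = ∑ I : DegIdx σ k, ∑ m ∈ p.support with half m = I.1, monomial m (coeff m p) :=
          (Finset.sum_coe_sort (degMonomials σ k)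
            (fun I => ∑ m ∈ p.support with half m = I, monomial m (coeff m p))).symm
      _ = ∑ I, f I * g I := Finset.sum_congr rfl fun I _ => (h1 I).symm
  calc bRank k p ≤ Fintype.card (DegIdx σ k) :=
        bRank_le_of_eq_sum f g (fun I => isHomogeneous_monomial _ (mem_degMonomials_iff.1 I.2))
          (fun I => IsHomogeneous.sum _ _ _ fun m hm => by
            obtain ⟨hm, hI⟩ := Finset.mem_filter.1 hm
            refine isHomogeneous_monomial _ ?_
            have h := congrArg Finsupp.degree (add_tsub_cancel_of_le (hhalf m hm).1)
            rw [map_add, (hhalf m hm).2, hdeg m hm] at h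
            rw [← hI]; omega) hfg
    _ = (degMonomials σ k).card := by simp

/-- **Yabe 2015, Proposition 2.6, second inequality** (p0006): `s_k = |𝓘_{k,D}| ≤ D^k` — every
degree-`k` monomial is a product of `k` variables, i.e. the word map `(Fin k → σ) → 𝓘_k` is onto
(for `σ = Fin n` this is the tree's `card_finsuppAntidiag_univ_le_pow`, `BasicTensorSubspaces.lean`;
the exact count `s_k = (D+k−1 choose k)` is Mathlib's `Finset.card_finsuppAntidiag_nat_eq_choose`).
[cite: Yabe2015, Proposition 2.6] -/
theorem card_degMonomials_le_pow (σ : Type v) [Fintype σ] [DecidableEq σ] (k : ℕ) :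
    (degMonomials σ k).card ≤ Fintype.card σ ^ k := by
  classical
  have hsurj : ∀ (j : ℕ) (m : σ →₀ ℕ), m.degree = j →
      ∃ w : Fin j → σ, (∑ i, Finsupp.single (w i) 1) = m := by
    intro j
    induction j with
    | zero => intro m hm; exact ⟨Fin.elim0, by simpa using ((Finsupp.degree_eq_zero_iff m).1 hm).symm⟩
    | succ j ih =>
        intro m hm
        have hm0 : m ≠ 0 := by rintro rfl; simp at hm
        obtain ⟨s, hs⟩ := Finsupp.support_nonempty_iff.2 hm0
        have hle : Finsupp.single s 1 ≤ m := Finsupp.single_le_iff.2 (by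
          have := Finsupp.mem_support_iff.1 hs; omega)
        obtain ⟨w', hw'⟩ := ih (m - Finsupp.single s 1) (by
          have h := congrArg Finsupp.degree (add_tsub_cancel_of_le hle)
          rw [map_add, Finsupp.degree_single, hm] at h
          omega)
        refine ⟨Fin.cons s w', ?_⟩
        rw [Fin.sum_univ_succ, Fin.cons_zero]
        simp only [Fin.cons_succ]
        rw [hw', add_tsub_cancel_of_le hle]
  let F : (Fin k → σ) → DegIdx σ k := fun w =>
    ⟨∑ i, Finsupp.single (w i) 1, mem_degMonomials_iff.2 (by simp)⟩
  have hF : Function.Surjective F := fun I => by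
    obtain ⟨w, hw⟩ := hsurj k I.1 (mem_degMonomials_iff.1 I.2)
    exact ⟨w, Subtype.ext hw⟩
  calc (degMonomials σ k).card = Fintype.card (DegIdx σ k) := by simp [DegIdx]
    _ ≤ Fintype.card (Fin k → σ) := Fintype.card_le_of_surjective F hF
    _ = Fintype.card σ ^ k := by simp

end UpperBound

/-! ### Thm. 1.5, Cor. 1.6, Thm. 1.7, Prop. 2.7, Lemma 2.8 (determinantal complexity vs `brank`) -/

section MainTheorem

/-- **Yabe 2015, Theorem 1.5 (main theorem)** (p0003): "For a polynomial `p ∈ K[x]` (`K` a field,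
`x = (x_1,…,x_D)`), `k ∈ [1, D]`, and `x₀ ∈ Zeros(p)`, it holds that
`dc(p) ≥ (1/2^{2k−2})·brank(p_{x₀}^{(2k)}) − 2(k−1)·D^{k−1}`", where `p_{x₀}(x) := p(x + x₀)` and
`q^{(j)}` is the degree-`j` homogeneous part. Typed with denominators cleared:
`brank((p_{x₀})^{(2k)}) ≤ 2^{2k−2}·(dc(p) + 2(k−1)·D^{k−1})` (equivalent for natural numbers); the
`ℕ` subtractions `2k−2`, `k−1` are exact under the printed hypothesis `1 ≤ k`. `dc` is the attained
`sInf` `determinantalComplexity` (Valiant universality), `p_{x₀} = transl x₀ p`. The printed proof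
(§5: Lemma 5.1, Prop. 5.2 via clow sequences, Lemma 5.3) is over an arbitrary field. Not yet proved
in tree (R2-dischargeable). [cite: Yabe2015, Theorem 1.5] -/
def yabe2015_thm_1_5 : Prop :=
  ∀ (K : Type u) [Field K] (σ : Type v) [Fintype σ] [DecidableEq σ] (p : MvPolynomial σ K) (k : ℕ)
    (x₀ : σ → K), 1 ≤ k → k ≤ Fintype.card σ → eval x₀ p = 0 →
    bRank k (homogeneousComponent (2 * k) (transl x₀ p)) ≤
      2 ^ (2 * k - 2) * (determinantalComplexity p + 2 * (k - 1) * Fintype.card σ ^ (k - 1))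

/-- **Yabe 2015, Corollary 1.6** (p0003): "Let `k ≥ 1` be an arbitrary integer. If there exists a
sequence of matrices `X_d ∈ Zeros(perm_d)` for `d = 1, 2, …` such that
`brank(perm_{d,X_d}^{(2k)}) = Ω(d^{2k})`, then `dc(perm_d) = Ω(d^{2k})`." Typed with `Ω` unfolded
to explicit constants (`∃ c > 0, ∃ N, ∀ d ≥ N, c·d^{2k} ≤ ·`), over the field `K` of Thm. 1.5
(`per_d = perPoly (Fin d) K` in `D = d²` variables); the zero condition is asked for `d ≥ 1` only
(`per_0 = 1` has no zero, and the source's sequence starts at `d = 1`). A bookkeeping consequence of Thm. 1.5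
(`2(k−1)·(d²)^{k−1} = o(d^{2k})`); not yet proved in tree. [cite: Yabe2015, Corollary 1.6] -/
def yabe2015_cor_1_6 : Prop :=
  ∀ (K : Type u) [Field K] (k : ℕ), 1 ≤ k →
    ∀ X : (d : ℕ) → (Fin d × Fin d → K), (∀ d, 1 ≤ d → eval (X d) (perPoly (Fin d) K) = 0) →
    (∃ c : ℝ, 0 < c ∧ ∃ N : ℕ, ∀ d ≥ N,
      c * (d : ℝ) ^ (2 * k) ≤ bRank k (homogeneousComponent (2 * k) (transl (X d) (perPoly (Fin d) K)))) →
    ∃ c : ℝ, 0 < c ∧ ∃ N : ℕ, ∀ d ≥ N,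
      c * (d : ℝ) ^ (2 * k) ≤ determinantalComplexity (perPoly (Fin d) K)

/-- **Yabe 2015, Theorem 1.7** (p0003; proof §3.2, p0008–p0009): "Over the field `ℝ`, it holds that
`dc(perm_d) ≥ (d−1)² + 1`." Typed for `d ≥ 1` (the source's `perm_d` is the `d × d` permanent,
`d ≥ 1`; for `d = 0`, `per_0 = 1` has `dc = 0`): `(d−1)² + 1 ≤ dc(perPoly (Fin d) ℝ)`, the `ℕ`
subtraction being exact for `d ≥ 1`. For `d = 1, 2` the bound is the degree bound `d ≤ dc(per_d)`;
the printed proof (Thm. 1.5 with `k = 1` at the Mignon–Ressayre zero `Σ_d` — the tree's `mrPoint`,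
up to a row/column permutation — then Lemma 3.1 and the signature `(2d−2, (d−1)²+1, 0)` of the
Hessian `H_{per_d, Σ_d}`) is written for `d ≥ 3` (it uses `(d−3)!`, `B⁻¹`, `1/(d−2)`). This improves
Mignon–Ressayre's `d²/2` (in tree: `sq_le_two_mul_determinantalComplexity_perPoly_charZero_holds`)
over `ℝ` only (real representations); over `ℂ` the record remains `d²/2`. Typing cross-check (this
seat, exact arithmetic): inertia of `H_{per_d,Σ_d}` is `(4,5,0), (6,10,0), (8,17,0), (10,26,0)` for
`d = 3,4,5,6`, matching `(2d−2, (d−1)²+1, 0)`. Not yet proved in tree (discharge route: the tree's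
`rank_hessianMatrix_detPoly_le` argument shows the Hessian form of `det ∘ A` at a zero vanishes on a
subspace of codimension `≤ m`, whence each inertia index is `≤ m = dc`; plus the negative index of
`mrHess`; the first half of this route is PROVED below as `yabe2015_signature_le_determinantalComplexity`:
`max(n₊,n₋)(H_{p,x₀}) ≤ dc(p)` at every real zero, so what remains is `n₋(H_{per_d,Σ_d}) ≥ (d−1)²+1`).
[cite: Yabe2015, Theorem 1.7] -/
def yabe2015_thm_1_7 : Prop :=
  ∀ d : ℕ, 1 ≤ d → (d - 1) ^ 2 + 1 ≤ determinantalComplexity (perPoly (Fin d) ℝ)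

/-- **Yabe 2015, Proposition 2.7** (p0006): "For a polynomial `p ∈ K[x]`, `k ∈ ℕ`, and
`x₀ ∈ K^D ∖ Zeros(p)`, it holds that `dc(p) ≥ √(brank(p_{x₀}^{(2k)}))`" (the weaker bound at a
NON-zero, via Mahajan–Vinay ABPs of width `n²` for the coefficients of `det(A(x) + λI)`, Thm. 2.11).
Typed squared: `brank((p_{x₀})^{(2k)}) ≤ dc(p)²`, for `k ≥ 1` (the source's `ℕ` in this statement is
read as positive integers, as in Thm. 1.5's `k ∈ [1,D]`: for `k = 0` and `p = 1` — `dc(1) = 0`,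
`brank_0(1) = 1` — the displayed inequality would fail). Not yet proved in tree (R2).
[cite: Yabe2015, Proposition 2.7] -/
def yabe2015_prop_2_7 : Prop :=
  ∀ (K : Type u) [Field K] (σ : Type v) [Fintype σ] [DecidableEq σ] (p : MvPolynomial σ K) (k : ℕ)
    (x₀ : σ → K), 1 ≤ k → eval x₀ p ≠ 0 →
    bRank k (homogeneousComponent (2 * k) (transl x₀ p)) ≤ determinantalComplexity p ^ 2

/-- **Yabe 2015, Lemma 2.8** (p0006): "Let `p ∈ K[x]` with `dc(p) = n`. Then, for all
`x₀ ∈ K^D ∖ Zeros(p)`, there exist a linear polynomial matrix `A ∈ (K[x])^{n×n}` and `α ∈ ℝ` [sic;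
read `α ∈ K` — the proof sets `α := det Q(x₀) = p_{x₀}(0)`] such that `p_{x₀}(x) = α·det(A(x) + I)`."
"Linear polynomial matrix" = every entry a HOMOGENEOUS linear form (§5, p0011), typed as
`IsHomogeneous · 1`. Not yet proved in tree (R2: `A := Q(x₀)⁻¹ L(x)`). [cite: Yabe2015, Lemma 2.8] -/
def yabe2015_lemma_2_8 : Prop :=
  ∀ (K : Type u) [Field K] (σ : Type v) [Fintype σ] [DecidableEq σ] (p : MvPolynomial σ K) (n : ℕ)
    (x₀ : σ → K), determinantalComplexity p = n → eval x₀ p ≠ 0 →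
    ∃ (A : Matrix (Fin n) (Fin n) (MvPolynomial σ K)) (α : K), (∀ i j, (A i j).IsHomogeneous 1) ∧
      transl x₀ p = C α * (A + 1).det

end MainTheorem

/-! ### §2.1: `brank` as rank minimisation (Thm. 2.1, Cors. 2.2–2.3, the affine space `𝒳_p`) -/

section RankMinimisation

/-- **Yabe 2015, Theorem 2.1** (p0005): "For `p ∈ K[x]^{(2k)}`, `brank(p)` is equal to the optimum
value of the following problem: Minimize `rank(Q)` subject to `p(x) = v(x)ᵀ Q v(x)`,
`Q ∈ Mat_{s_k}(K)`." Typed with the optimum as an `sInf` over `ℕ` of the ranks of the feasible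
`Q : Matrix 𝓘_k 𝓘_k K` (`gramPoly k Q = p`); for homogeneous `p` of degree `2k` the feasible set is
nonempty (proof of Thm. 2.1 / Prop. 2.6), so neither side is a junk value. Not yet proved in tree
(R2: a rank-`r` matrix over a field is a sum of `r` rank-one matrices `f gᵀ`, and conversely).
[cite: Yabe2015, Theorem 2.1] -/
def yabe2015_thm_2_1 : Prop :=
  ∀ (K : Type u) [Field K] (σ : Type v) [Fintype σ] [DecidableEq σ] (k : ℕ) (p : MvPolynomial σ K),
    p.IsHomogeneous (2 * k) →
    bRank k p = sInf (Matrix.rank '' {Q : Matrix (DegIdx σ k) (DegIdx σ k) K |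
      gramPoly k Q = p})

/-- **Yabe 2015, Corollary 2.2** (p0005): "For `p ∈ ℝ[x]^{(2k)}`, `brank(p)` is at least the half of
the optimum value of the following problem: Minimize `rank(Q)` subject to `p(x) = v(x)ᵀ Q v(x)`,
`Q ∈ Sym_{s_k}`" (symmetrise: `Q = (Q' + Q'ᵀ)/2`, `rank Q ≤ 2 rank Q'`). Typed as
`sInf{rank Q | Q symmetric, v(x)ᵀQv(x) = p} ≤ 2·brank(p)`. Not yet proved in tree (R2, from Thm. 2.1).
[cite: Yabe2015, Corollary 2.2] -/
def yabe2015_cor_2_2 : Prop :=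
  ∀ (σ : Type v) [Fintype σ] [DecidableEq σ] (k : ℕ) (p : MvPolynomial σ ℝ),
    p.IsHomogeneous (2 * k) →
    sInf (Matrix.rank '' {Q : Matrix (DegIdx σ k) (DegIdx σ k) ℝ |
      Q.IsSymm ∧ gramPoly k Q = p}) ≤ 2 * bRank k p

/-- **Yabe 2015, Corollary 2.3** (p0005): "For `p ∈ ℝ[x]^{(2k)}`, `brank(p)` is at least the half of
the optimum value of the following problem: Minimize `rank(Q₊) + rank(Q₋)` subject to
`p(x) = v(x)ᵀ(Q₊ − Q₋)v(x)`, `Q₊, Q₋ ∈ Psd_{s_k}`" (split a symmetric `Q` as `Q₊ − Q₋` with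
`rank Q = rank Q₊ + rank Q₋`). Typed as `sInf{rank Q₊ + rank Q₋ | …} ≤ 2·brank(p)` with Mathlib's
`Matrix.PosSemidef` over `ℝ`. Not yet proved in tree (R2, from Cor. 2.2 and the spectral theorem).
[cite: Yabe2015, Corollary 2.3] -/
def yabe2015_cor_2_3 : Prop :=
  ∀ (σ : Type v) [Fintype σ] [DecidableEq σ] (k : ℕ) (p : MvPolynomial σ ℝ),
    p.IsHomogeneous (2 * k) →
    sInf ((fun QQ : Matrix (DegIdx σ k) (DegIdx σ k) ℝ ×
        Matrix (DegIdx σ k) (DegIdx σ k) ℝ => QQ.1.rank + QQ.2.rank) ''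
      {QQ | QQ.1.PosSemidef ∧ QQ.2.PosSemidef ∧ gramPoly k (QQ.1 - QQ.2) = p}) ≤ 2 * bRank k p

/-- The affine space `𝒳_p ⊆ Sym_{2s_k}` of Yabe 2015, §2.1 (p0005): the pairs `(Q₊, Q₋)` of symmetric
`s_k × s_k` matrices with `p(x) = v(x)ᵀ(Q₊ − Q₋)v(x)`, embedded block-diagonally
`(Q₊, Q₋) ↦ diag(Q₊, Q₋)` into the symmetric matrices of size `2s_k` (index type `𝓘_k ⊕ 𝓘_k`);
`𝒳_p ∩ Psd_{2s_k}` is the feasible region of Cor. 2.3. [cite: Yabe2015, §2.1] -/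
def gramPairSet {σ : Type v} [Fintype σ] [DecidableEq σ] (k : ℕ) (p : MvPolynomial σ ℝ) :
    Set (Matrix (DegIdx σ k ⊕ DegIdx σ k) (DegIdx σ k ⊕ DegIdx σ k) ℝ) :=
  {M | ∃ Qp Qm : Matrix (DegIdx σ k) (DegIdx σ k) ℝ, Qp.IsSymm ∧ Qm.IsSymm ∧
    M = Matrix.fromBlocks Qp 0 0 Qm ∧ gramPoly k (Qp - Qm) = p}

end RankMinimisation

/-! ### §2.2: `brank` of generic polynomials (Thm. 2.4, Prop. 2.5) -/

section Generic

/-- **Yabe 2015, Theorem 2.4** (p0005–p0006; `K` algebraically closed of characteristic `0`, §2.2):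
"Let `S := {q ∈ K[x]^{(2k)} | brank(q) ≤ r} ⊆ K^{s_{2k}}`. Then the Zariski closure `S̄` is an
irreducible variety having dimension at most `r(2s_k − r)`" (`S = π(Z_r)` is a linear projection of
the determinantal variety of `s_k × s_k` matrices of rank `≤ r`). Typed on coefficient vectors
`q ↦ (coeff_I q)_{I ∈ 𝓘_{2k}}` (the tree's `formCoeff (2k)`, `OrbitCoordinateRing.lean`): the vanishing ideal `I(S)` is prime (⇔ `S̄` irreducible;
`0 ∈ S`, so `S ≠ ∅`) and the coordinate ring `K[𝓘_{2k}]/I(S)` of `S̄` has Krull dimension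
`≤ r(2s_k − r)`. Typed for `r ≤ s_k` (the determinantal-variety dimension formula `r(2s_k − r)` is the
one for `r ≤ s_k`; for `r ≥ s_k`, `S` is everything), so the `ℕ` subtraction is exact. Not yet
proved in tree (dimension theory of determinantal varieties, [Harris 1995]). [cite: Yabe2015, Theorem 2.4] -/
def yabe2015_thm_2_4 : Prop :=
  ∀ (K : Type u) [Field K] [IsAlgClosed K] [CharZero K] (σ : Type v) [Fintype σ] [DecidableEq σ]
    (k r : ℕ), r ≤ (degMonomials σ k).card →
    let S : Set (DegIdx σ (2 * k) → K) :=
      formCoeff (2 * k) '' {q : MvPolynomial σ K | q.IsHomogeneous (2 * k) ∧ bRank k q ≤ r}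
    (MvPolynomial.vanishingIdeal K S).IsPrime ∧
      ringKrullDim (MvPolynomial (DegIdx σ (2 * k)) K ⧸ MvPolynomial.vanishingIdeal K S) ≤
        (r * (2 * (degMonomials σ k).card - r) : ℕ)

/-- **Yabe 2015, Proposition 2.5** (p0006): "For a polynomial `p ∈ ℂ[x]^{(2k)}` with algebraically
independent coefficients over `ℚ`, it holds that `brank(p) ≥ k!·D^k / (2·(2k)!)`" (from Thm. 2.4:
`r(2s_k − r) ≥ s_{2k}` forces `r ≥ s_{2k}/(2s_k) ≥ k!D^k/(2(2k)!)`). "Coefficients" = the `s_{2k}`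
coefficients `(coeff_I p)_{I ∈ 𝓘_{2k}}` of the homogeneous `p` (the tree's `formCoeff (2k) p`); typed with denominators cleared:
`k!·D^k ≤ 2·(2k)!·brank(p)`. Not yet proved in tree. [cite: Yabe2015, Proposition 2.5] -/
def yabe2015_prop_2_5 : Prop :=
  ∀ (σ : Type v) [Fintype σ] [DecidableEq σ] (k : ℕ) (p : MvPolynomial σ ℂ),
    p.IsHomogeneous (2 * k) →
    AlgebraicIndependent ℚ (formCoeff (2 * k) p) →
    k.factorial * Fintype.card σ ^ k ≤ 2 * (2 * k).factorial * bRank k p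

end Generic

/-! ### §3: `k = 1` — Hessian rank and signature (§3.1, Lemma 3.1) -/

section HessianCase

/-- **Yabe 2015, §3.1** (p0008, inside "An alternative proof of Theorem 1.3"): for `p ∈ K[x]` and
`x₀ ∈ Zeros(p)`, `p_{x₀}^{(2)}(x) = ½ Σ_{i,j} x_i x_j (∂²p/∂x_i∂x_j)(x₀)`, and if
`p_{x₀}^{(2)} = Σ_{m≤n} (Σ_l b^m_l x_l)(Σ_l c^m_l x_l)` then `A := Σ_m b^m (c^m)ᵀ` has
`A + Aᵀ = H_{p,x₀}` and rank `≤ n`; hence "`brank(p_{x₀}^{(2)}) ≥ rank(A) ≥ ½ rank(H_{p,x₀})`".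
Typed as `rank(hessianMatrix p x₀) ≤ 2·brank((p_{x₀})^{(2)})` over a field of CHARACTERISTIC `0`
(the displayed identity divides by `2`; the section re-proves Thm. 1.3 = Mignon–Ressayre, a
characteristic-`0` statement); the zero hypothesis is not needed for this inequality and is omitted.
With Thm. 1.5 (`k = 1`: `dc(p) ≥ brank(p_{x₀}^{(2)})`) this recovers the tree's
`rank_hessianMatrix_le_two_mul_determinantalComplexity`. Not yet proved in tree (R2).
[cite: Yabe2015, §3.1] -/
def yabe2015_rank_hessian_le_two_mul_bRank : Prop :=
  ∀ (K : Type u) [Field K] [CharZero K] (σ : Type v) [Fintype σ] [DecidableEq σ]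
    (p : MvPolynomial σ K) (x₀ : σ → K),
    (hessianMatrix p x₀).rank ≤ 2 * bRank 1 (homogeneousComponent 2 (transl x₀ p))

/-- **Yabe 2015, Lemma 3.1** (p0008): "Let `Q ∈ Mat_n(ℝ)`, `Q_sym := Q + Qᵀ`, and `(n₊, n₋, n₀)` be
the signature of `Q_sym` [numbers of positive, negative, zero eigenvalues]. Then it holds that
`rank(Q) ≥ max{n₊, n₋}`" (for `u ≠ 0` in the span of the positive eigenvectors,
`2uᵀQu = uᵀQ_sym u > 0`, so `Qu ≠ 0`). Typed with Mathlib's spectrum of the symmetric matrix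
`Q + Qᵀ` (`Matrix.IsHermitian.eigenvalues` of `isHermitian_add_transpose_self Q`; over `ℝ`,
`Qᴴ = Qᵀ`). Not yet proved in tree (R2; the Courant–Fischer counting form
`Literature.Analysis.Matrix.EigenvalueCount.le_card_eigenvalues_gt` is the tool).
[cite: Yabe2015, Lemma 3.1] -/
def yabe2015_lemma_3_1 : Prop :=
  ∀ (n : Type v) [Fintype n] [DecidableEq n] (Q : Matrix n n ℝ),
    max (Finset.univ.filter fun i => 0 < (isHermitian_add_transpose_self Q).eigenvalues i).card
        (Finset.univ.filter fun i => (isHermitian_add_transpose_self Q).eigenvalues i < 0).card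
      ≤ Q.rank

end HessianCase

/-! ### §4.1: concave minimisation certificates (Lemma 4.1, Thm. 4.5, Prop. 1.8) -/

section Concave

/-- `μ_l(Y)`, "the sum of the smallest `l` eigenvalues of `Y`" for a real symmetric `Y` of size `n`
(Yabe 2015, §1 p0004 and §4.1 p0010), in the convention of the tree's Ky Fan file
(`Literature/Analysis/Matrix/KyFanMaximumPrinciple.lean`: Mathlib's decreasing enumeration
`eigenvalues₀`, tail indices `rev 0, …, rev (l−1)`). JUNK VALUE `0` when `Y` is not symmetric or
`l > n` (documented; every use below is under `Y.IsSymm` and `l ≤ n`). [cite: Yabe2015, §4.1] -/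
def sumSmallestEig {n : Type v} [Fintype n] [DecidableEq n] (Y : Matrix n n ℝ) (l : ℕ) : ℝ :=
  if h : Y.IsHermitian ∧ l ≤ Fintype.card n then
    ∑ t : Fin l, h.1.eigenvalues₀ (Fin.rev (Fin.castLE h.2 t))
  else 0

/-- `minrank(𝒳) := min_{X ∈ 𝒳} rank(X)` for a set of square matrices (Yabe 2015, §4.1, p0010), as an
`sInf` over `ℕ` (junk value `0` for `𝒳 = ∅`; the statements below assume `𝒳 ≠ ∅`, where the printed
`min` is `+∞`). [cite: Yabe2015, §4.1] -/
def minRank {K : Type u} [Field K] {n : Type v} [Fintype n] (𝒳 : Set (Matrix n n K)) : ℕ :=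
  sInf (Matrix.rank '' 𝒳)

/-- **Yabe 2015, Lemma 4.1** (p0010): "Let `𝒳 ⊆ Psd_n`, and `r ∈ ℕ`. Then `minrank(𝒳) > r` if and only
if `μ_{n−r}(X) > 0` for all `X ∈ 𝒳`" (a psd matrix has rank `> r` iff its `n − r` smallest
eigenvalues are not all `0`). Typed for NONEMPTY `𝒳` (for `𝒳 = ∅` the printed `min` is `+∞` while
`minRank ∅ = 0`); `n − r` is `ℕ` subtraction (`μ_0 = 0`, consistent with the source for `r ≥ n`).
Not yet proved in tree (R2: `Matrix.IsHermitian.rank_eq_card_non_zero_eigs`).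
[cite: Yabe2015, Lemma 4.1] -/
def yabe2015_lemma_4_1 : Prop :=
  ∀ (n : Type v) [Fintype n] [DecidableEq n] (𝒳 : Set (Matrix n n ℝ)) (r : ℕ), 𝒳.Nonempty →
    (∀ X ∈ 𝒳, X.PosSemidef) →
    (r < minRank 𝒳 ↔ ∀ X ∈ 𝒳, 0 < sumSmallestEig X (Fintype.card n - r))

/-- **Yabe 2015, Theorem 4.5** (p0010): "Let `𝒳 ⊆ Psd_n` and `r ∈ ℕ`. If there exists `𝒴 ⊆ Sym_n`
satisfying the following property, then `minrank(𝒳) > r`. (i) `𝒳 ⊆ conv(𝒴)`. (ii) `μ_{n−r}(Y) > 0`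
for all `Y ∈ 𝒴`" (outer approximation: `μ_{n−r}` is concave — Cor. 4.4, in tree as
`Literature.Analysis.Matrix.KyFan.sum_eigenvalues₀_tail_add_ge` — so its minimum over `conv(𝒴)` is
attained on `𝒴`; then Lemma 4.1). Typed for NONEMPTY `𝒳` (see `yabe2015_lemma_4_1`), `conv` =
`convexHull ℝ` in the real vector space of `n × n` matrices. Not yet proved in tree (R2).
[cite: Yabe2015, Theorem 4.5] -/
def yabe2015_thm_4_5 : Prop :=
  ∀ (n : Type v) [Fintype n] [DecidableEq n] (𝒳 : Set (Matrix n n ℝ)) (r : ℕ), 𝒳.Nonempty →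
    (∀ X ∈ 𝒳, X.PosSemidef) →
    (∃ 𝒴 : Set (Matrix n n ℝ), (∀ Y ∈ 𝒴, Y.IsSymm) ∧ 𝒳 ⊆ convexHull ℝ 𝒴 ∧
      ∀ Y ∈ 𝒴, 0 < sumSmallestEig Y (Fintype.card n - r)) →
    r < minRank 𝒳

/-- **Yabe 2015, Proposition 1.8** (p0004): "Let `p ∈ ℝ[x]^{(2k)}`, `r ∈ ℕ`, and `n = 2s_k`. If there
exists `𝒴 ⊆ Sym_n` satisfying the following property, then `brank(p) > r/2`. (i)
`𝒳_p ∩ Psd_n ⊆ conv(𝒴)`. (ii) `μ_{n−r}(Y) > 0` for all `Y ∈ 𝒴`" (= Cor. 2.3 + Thm. 4.5; proof §4.1,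
p0010). Typed with `𝒳_p = gramPairSet k p` (size `n = 2s_k`, index `𝓘_k ⊕ 𝓘_k`), conclusion
`r < 2·brank(p)`. Not yet proved in tree (R2). [cite: Yabe2015, Proposition 1.8] -/
def yabe2015_prop_1_8 : Prop :=
  ∀ (σ : Type v) [Fintype σ] [DecidableEq σ] (k : ℕ) (p : MvPolynomial σ ℝ) (r : ℕ),
    p.IsHomogeneous (2 * k) →
    (∃ 𝒴 : Set (Matrix (DegIdx σ k ⊕ DegIdx σ k) (DegIdx σ k ⊕ DegIdx σ k) ℝ),
      (∀ Y ∈ 𝒴, Y.IsSymm) ∧ {M | M ∈ gramPairSet k p ∧ M.PosSemidef} ⊆ convexHull ℝ 𝒴 ∧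
      ∀ Y ∈ 𝒴, 0 < sumSmallestEig Y
        (Fintype.card (DegIdx σ k ⊕ DegIdx σ k) - r)) →
    r < 2 * bRank k p

end Concave

/-! ### §5: the normal form at a zero and the key estimate (Lemma 5.1, Prop. 5.2) -/

section ProofArchitecture

/-- `Λ_n^r`, "the diagonal matrix of size `n` with diagonal entries `(0,…,0,1,…,1)` (`r` ones)"
(Yabe 2015, §5, p0011), over any semiring. [cite: Yabe2015, §5] -/
def lambdaDiag (R : Type u) [Semiring R] (n r : ℕ) : Matrix (Fin n) (Fin n) R :=
  Matrix.diagonal fun i => if n - r ≤ (i : ℕ) then 1 else 0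

/-- **Yabe 2015, Lemma 5.1** (p0011): "Let `p ∈ K[x]` with `dc(p) = n`. Then, for all
`x₀ ∈ Zeros(p)`, there exist a linear polynomial matrix `A ∈ (K[x])^{n×n}` and `r ∈ [0, n−1]` such
that `p_{x₀}(x) = det(A(x) + Λ_n^r)`" (`r = rank Q(x₀)`; `S Q(x₀) T = Λ_n^r` with `det(ST) = 1`).
"Linear polynomial matrix" = entries homogeneous of degree `1`. (For `n = 0`, `p = 1` has no zero,
matching the empty range `[0, −1]`.) Not yet proved in tree (R2: rank normal form over a field).
[cite: Yabe2015, Lemma 5.1] -/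
def yabe2015_lemma_5_1 : Prop :=
  ∀ (K : Type u) [Field K] (σ : Type v) [Fintype σ] [DecidableEq σ] (p : MvPolynomial σ K) (n : ℕ)
    (x₀ : σ → K), determinantalComplexity p = n → eval x₀ p = 0 →
    ∃ (A : Matrix (Fin n) (Fin n) (MvPolynomial σ K)) (r : ℕ), (∀ i j, (A i j).IsHomogeneous 1) ∧
      r + 1 ≤ n ∧ transl x₀ p = (A + (lambdaDiag K n r).map C).det

/-- **Yabe 2015, Proposition 5.2** (p0011, "the essence of our result"): "For `A ∈ (K[x])^{n×n}`
[a linear polynomial matrix, `D` variables], it holds that `brank(p_{A,2k,n−1}) ≤ n + 2(k−1)D^{k−1}`",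
where `p_{A,j,r} := (det(A(x) + Λ_n^r))^{(j)}`. Typed for `k ≥ 1` (so that `k − 1` is exact; `𝓘_k`,
`s_k` presuppose `k ≥ 1` in the source). Proof in the source: §5.1, an explicit width-bounded ABP
from Mahajan–Vinay clow sequences. Not yet proved in tree (R2). [cite: Yabe2015, Proposition 5.2] -/
def yabe2015_prop_5_2 : Prop :=
  ∀ (K : Type u) [Field K] (σ : Type v) [Fintype σ] [DecidableEq σ] (n k : ℕ)
    (A : Matrix (Fin n) (Fin n) (MvPolynomial σ K)), 1 ≤ k → (∀ i j, (A i j).IsHomogeneous 1) →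
    bRank k (homogeneousComponent (2 * k) (A + (lambdaDiag K n (n - 1)).map C).det) ≤
      n + 2 * (k - 1) * Fintype.card σ ^ (k - 1)

end ProofArchitecture

/-! ### §3.1 discharged: `rank H_{p,x₀} ≤ 2 · brank(p_{x₀}^{(2)})` (val-lit t10) -/

section HessianCaseProof

variable {K : Type u} [CommRing K] {σ : Type v}

/-- An entry of the Hessian at the origin is a degree-`2` coefficient: `H(f)(0)_{st} =
(δ_{st} + 1) · coeff_{e_s + e_t} f`. [folklore] -/
private theorem hess0_apply_eq_coeff (f : MvPolynomial σ K) (s t : σ) :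
    hess0 f s t = coeff (Finsupp.single s 1 + Finsupp.single t 1) f *
      (((Finsupp.single s 1 : σ →₀ ℕ) t : K) + 1) := by
  rw [hess0_apply]
  show coeff 0 (pderiv s (pderiv t f)) = _
  rw [coeff_pderiv, zero_add, coeff_pderiv]
  simp

/-- The Hessian at the origin only sees the quadratic part: `H(f)(0) = H(f^{(2)})(0)`.
[folklore] -/
private theorem hess0_eq_hess0_homogeneousComponent_two (f : MvPolynomial σ K) :
    hess0 f = hess0 (homogeneousComponent 2 f) := by
  ext s t
  rw [hess0_apply_eq_coeff, hess0_apply_eq_coeff, coeff_homogeneousComponent, if_pos]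
  rw [map_add, Finsupp.degree_single, Finsupp.degree_single]

/-- The Hessian at the origin of a product of two LINEAR forms `f = Σ b_l x_l`, `g = Σ c_l x_l` is
`b cᵀ + c bᵀ` (Yabe 2015, §3.1, p0008: "`A_m = (b^m_i c^m_j)` … `A + Aᵀ = H_{p,x₀}`").
[cite: Yabe2015, §3.1] -/
theorem hess0_mul_of_isHomogeneous_one {f g : MvPolynomial σ K} (hf : f.IsHomogeneous 1)
    (hg : g.IsHomogeneous 1) :
    hess0 (f * g) = vecMulVec (linPart f) (linPart g) + vecMulVec (linPart g) (linPart f) := by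
  have hf0 : constantCoeff f = 0 := by
    rw [constantCoeff_eq]
    exact hf.coeff_eq_zero (by simp)
  have hg0 : constantCoeff g = 0 := by
    rw [constantCoeff_eq]
    exact hg.coeff_eq_zero (by simp)
  rw [hess0_mul, hf0, hg0, zero_smul, zero_smul, zero_add, zero_add]

variable [Fintype σ]

/-- Subadditivity of the rank over a finite sum (cf. `rank_sum_le` in `MignonRessayreBound.lean`,
not imported here; from `rank_add_le` of `HessianRank.lean`). [folklore] -/
private theorem rank_finset_sum_le {L : Type u} [Field L] {ι : Type*} (s : Finset ι)
    (A : ι → Matrix σ σ L) : (∑ i ∈ s, A i).rank ≤ ∑ i ∈ s, (A i).rank := by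
  classical
  induction s using Finset.induction_on with
  | empty => simp
  | insert a s ha ih =>
      rw [Finset.sum_insert ha, Finset.sum_insert ha]
      exact (rank_add_le _ _).trans (Nat.add_le_add_left ih _)

omit [Fintype σ] in
/-- The Hessian at a point (`hessianMatrix`, `HessianRank.lean`) is the Hessian at the origin of the
translate (`hess0 ∘ transl`, `HessianAtOrigin.lean`). [folklore] -/
private theorem hessianMatrix_eq_hess0_transl' (f : MvPolynomial σ K) (x : σ → K) :
    hessianMatrix f x = hess0 (transl x f) := by
  ext s t
  rw [hessianMatrix_apply, hess0_transl]

omit [Fintype σ] in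
/-- A homogeneous polynomial of degree `2k` IS a sum of products of pairs of degree-`k` forms, so the
set in the definition of `bRank k p` is nonempty and the infimum is attained (Yabe 2015, Prop. 2.6,
p0006, the decomposition behind `brank(p) ≤ s_k`; same splitting of monomials as in
`bRank_le_card_degMonomials`). [cite: Yabe2015, Proposition 2.6] -/
theorem exists_eq_sum_mul_of_isHomogeneous [DecidableEq σ] {k : ℕ} {p : MvPolynomial σ K}
    (hp : p.IsHomogeneous (2 * k)) :
    ∃ f g : Fin (bRank k p) → MvPolynomial σ K,
      (∀ i, (f i).IsHomogeneous k) ∧ (∀ i, (g i).IsHomogeneous k) ∧ p = ∑ i, f i * g i := by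
  classical
  -- nonemptiness: split every monomial `x^m` (`|m| = 2k`) as `x^I · x^{m-I}` with `|I| = k`
  have hdeg : ∀ m ∈ p.support, m.degree = 2 * k := fun m hm => by
    by_contra h
    exact (mem_support_iff.1 hm) (hp.coeff_eq_zero h)
  have hex : ∀ m : σ →₀ ℕ, ∃ I : σ →₀ ℕ, m ∈ p.support → I ≤ m ∧ I.degree = k := fun m => by
    by_cases hm : m ∈ p.support
    · obtain ⟨I, hI⟩ := exists_le_degree_eq m k (by rw [hdeg m hm]; omega)
      exact ⟨I, fun _ => hI⟩
    · exact ⟨0, fun h => (hm h).elim⟩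
  choose half hhalf using hex
  set f : p.support → MvPolynomial σ K := fun m => monomial (half m.1) 1 with hf
  set g : p.support → MvPolynomial σ K := fun m => monomial (m.1 - half m.1) (coeff m.1 p) with hg
  have hfh : ∀ m, (f m).IsHomogeneous k := fun m => isHomogeneous_monomial _ (hhalf m.1 m.2).2
  have hgh : ∀ m, (g m).IsHomogeneous k := fun m => by
    refine isHomogeneous_monomial _ ?_
    have h := congrArg Finsupp.degree (add_tsub_cancel_of_le (hhalf m.1 m.2).1)
    rw [map_add, (hhalf m.1 m.2).2, hdeg m.1 m.2] at h
    omega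
  have hfg : p = ∑ m, f m * g m := by
    have h1 : ∀ m : p.support, f m * g m = monomial m.1 (coeff m.1 p) := fun m => by
      rw [hf, hg, monomial_mul, one_mul, add_tsub_cancel_of_le (hhalf m.1 m.2).1]
    simp_rw [h1]
    rw [Finset.sum_coe_sort p.support (fun m => monomial m (coeff m p))]
    exact p.as_sum
  have hne : {n : ℕ | ∃ f g : Fin n → MvPolynomial σ K, (∀ i, (f i).IsHomogeneous k) ∧
      (∀ i, (g i).IsHomogeneous k) ∧ p = ∑ i, f i * g i}.Nonempty := by
    refine ⟨Fintype.card p.support, f ∘ (Fintype.equivFin _).symm, g ∘ (Fintype.equivFin _).symm,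
      fun i => hfh _, fun i => hgh _, ?_⟩
    conv_lhs => rw [hfg]
    exact Fintype.sum_equiv (Fintype.equivFin _) _ _ fun i => by
      simp [Function.comp, Equiv.symm_apply_apply]
  exact Nat.sInf_mem hne

/-- **Yabe 2015, §3.1 — DISCHARGE of `yabe2015_rank_hessian_le_two_mul_bRank`** (p0008: "We define
the rank one matrices `A_m = (b^m_i c^m_j)` … `A := Σ A_m`, and then it holds that
`A + Aᵀ = H_{p,x₀}`. Therefore we have `brank(p_{x₀}^{(2)}) ≥ rank(A) ≥ ½ rank(H_{p,x₀})`").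
Proof as printed, in tree vocabulary: `H_{p,x₀} = H(p(X + x₀))(0)` (`hess0_transl`) depends only on
the quadratic part `q = (p(X + x₀))^{(2)}`; a decomposition `q = Σ_{m < brank q} f_m g_m` into
products of linear forms (attained infimum, `exists_eq_sum_mul_of_isHomogeneous`) gives
`H = Σ_m (b_m c_mᵀ + c_m b_mᵀ)` (`hess0_mul_of_isHomogeneous_one`), a sum of `brank q` matrices
of rank `≤ 2`. No characteristic hypothesis is used (the fact carries `CharZero K` because the
source divides by `2`). [cite: Yabe2015, §3.1] -/
theorem yabe2015_rank_hessian_le_two_mul_bRank_holds : yabe2015_rank_hessian_le_two_mul_bRank := by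
  intro K _ _ σ _ _ p x₀
  classical
  set q := homogeneousComponent 2 (transl x₀ p) with hq
  have hqh : q.IsHomogeneous (2 * 1) := by
    simpa using homogeneousComponent_isHomogeneous 2 (transl x₀ p)
  obtain ⟨f, g, hf, hg, hfg⟩ := exists_eq_sum_mul_of_isHomogeneous hqh
  have hH : hessianMatrix p x₀ =
      ∑ i, (vecMulVec (linPart (f i)) (linPart (g i)) + vecMulVec (linPart (g i)) (linPart (f i))) := by
    rw [hessianMatrix_eq_hess0_transl', hess0_eq_hess0_homogeneousComponent_two, ← hq]
    conv_lhs => rw [hfg]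
    rw [map_sum]
    exact Finset.sum_congr rfl fun i _ => hess0_mul_of_isHomogeneous_one (hf i) (hg i)
  rw [hH]
  calc (∑ i, (vecMulVec (linPart (f i)) (linPart (g i)) +
          vecMulVec (linPart (g i)) (linPart (f i)))).rank
      ≤ ∑ i : Fin (bRank 1 q), (vecMulVec (linPart (f i)) (linPart (g i)) +
          vecMulVec (linPart (g i)) (linPart (f i))).rank := rank_finset_sum_le _ _
    _ ≤ ∑ _i : Fin (bRank 1 q), 2 := Finset.sum_le_sum fun i _ =>
        (rank_add_le _ _).trans (Nat.add_le_add (rank_vecMulVec_le _ _) (rank_vecMulVec_le _ _))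
    _ = 2 * bRank 1 q := by simp [mul_comm]

end HessianCaseProof

/-! ### Lemma 3.1 discharged: `rank Q ≥ max(n₊, n₋)` (val-lit t10) -/

section Lemma31Proof

open Literature.Analysis.Matrix.KyFan

variable {n : Type v} [Fintype n] [DecidableEq n]

/-- Core of Yabe 2015, Lemma 3.1: if the eigenvalues of the symmetric part `W = Q + Qᵀ` indexed by
`S` are all positive, or all negative, then `Q` is injective on the span of the corresponding
eigenvectors, so `|S| ≤ rank Q`. [cite: Yabe2015, Lemma 3.1] -/
theorem card_le_rank_of_eigenvalues_sign (Q : Matrix n n ℝ) (S : Finset n)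
    (hS : (∀ i ∈ S, 0 < (isHermitian_add_transpose_self Q).eigenvalues i) ∨
      (∀ i ∈ S, (isHermitian_add_transpose_self Q).eigenvalues i < 0)) :
    S.card ≤ Q.rank := by
  set hW := isHermitian_add_transpose_self Q with hWdef
  -- the eigenvectors indexed by `S`, as the columns of a matrix
  set U : Matrix n S ℝ := Matrix.of fun a i => (hW.eigenvectorBasis i.1).ofLp a with hU
  -- coordinates: `u_i ⬝ (U c) = c_i` on `S`, `0` off `S`
  have hcoord : ∀ (c : S → ℝ) (i : n), (hW.eigenvectorBasis i).ofLp ⬝ᵥ (U *ᵥ c) =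
      if h : i ∈ S then c ⟨i, h⟩ else 0 := by
    intro c i
    have hUc : U *ᵥ c = ∑ j : S, c j • (hW.eigenvectorBasis j.1).ofLp := by
      ext a
      simp [hU, mulVec, dotProduct, Finset.sum_apply, mul_comm]
    rw [hUc, dotProduct_sum]
    simp_rw [dotProduct_smul, eigenvectorBasis_dotProduct hW, smul_eq_mul]
    by_cases h : i ∈ S
    · rw [dif_pos h, Finset.sum_eq_single (⟨i, h⟩ : S)]
      · simp
      · intro j _ hj
        rw [if_neg fun h' => hj (Subtype.ext h'.symm), mul_zero]
      · exact fun h' => absurd (Finset.mem_univ _) h'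
    · rw [dif_neg h]
      refine Finset.sum_eq_zero fun j _ => ?_
      rw [if_neg (fun h' : i = j.1 => h (h'.symm ▸ j.2)), mul_zero]
  -- a sum `Σ_i μ_i t_i²` with `μ > 0` on `S` and `t = c` on `S`, `0` off `S`, vanishes only if `c = 0`
  have hzero : ∀ (μ : n → ℝ) (c : S → ℝ), (∀ i ∈ S, 0 < μ i) →
      ∑ i, μ i * (if h : i ∈ S then c ⟨i, h⟩ else 0) ^ 2 = 0 → c = 0 := by
    intro μ c hμ hsum
    have hnn : ∀ i ∈ (Finset.univ : Finset n),
        0 ≤ μ i * (if h : i ∈ S then c ⟨i, h⟩ else 0) ^ 2 := by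
      intro i _
      by_cases h : i ∈ S
      · rw [dif_pos h]; exact mul_nonneg (hμ i h).le (sq_nonneg _)
      · rw [dif_neg h]; simp
    have hall := (Finset.sum_eq_zero_iff_of_nonneg hnn).1 hsum
    funext j
    have hj := hall j.1 (Finset.mem_univ _)
    rw [dif_pos j.2] at hj
    rcases mul_eq_zero.1 hj with h0 | h0
    · exact absurd h0 (hμ j.1 j.2).ne'
    · simpa using h0
  -- `Q ∘ U` is injective
  have hinj : Function.Injective (Q * U).mulVecLin := by
    rw [← LinearMap.ker_eq_bot, LinearMap.ker_eq_bot']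
    intro c hc
    rw [Matrix.mulVecLin_apply, ← mulVec_mulVec] at hc
    set v := U *ᵥ c with hv
    -- `vᵀ W v = 2 vᵀ Q v = 0`
    have hWv : v ⬝ᵥ (Q + Qᴴ) *ᵥ v = 0 := by
      rw [conjTranspose_eq_transpose_of_trivial, add_mulVec, dotProduct_add, hc, dotProduct_zero,
        zero_add, mulVec_transpose, dotProduct_comm, ← dotProduct_mulVec, hc, dotProduct_zero]
    have hsum : ∑ i, hW.eigenvalues i * (if h : i ∈ S then c ⟨i, h⟩ else 0) ^ 2 = 0 := by
      calc ∑ i, hW.eigenvalues i * (if h : i ∈ S then c ⟨i, h⟩ else 0) ^ 2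
          = ∑ i, hW.eigenvalues i * ((hW.eigenvectorBasis i).ofLp ⬝ᵥ v) ^ 2 :=
            Finset.sum_congr rfl fun i _ => by rw [hv, hcoord]
        _ = v ⬝ᵥ (Q + Qᴴ) *ᵥ v := (dotProduct_mulVec_eq_sum_eigen hW v).symm
        _ = 0 := hWv
    rcases hS with hpos | hneg
    · exact hzero _ c hpos hsum
    · refine hzero (fun i => -hW.eigenvalues i) c (fun i hi => neg_pos.2 (hneg i hi)) ?_
      have hneg' : ∑ i, -hW.eigenvalues i * (if h : i ∈ S then c ⟨i, h⟩ else 0) ^ 2 =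
          -∑ i, hW.eigenvalues i * (if h : i ∈ S then c ⟨i, h⟩ else 0) ^ 2 := by
        rw [← Finset.sum_neg_distrib]
        exact Finset.sum_congr rfl fun i _ => by rw [neg_mul]
      rw [hneg', hsum, neg_zero]
  calc S.card = Fintype.card S := (Fintype.card_coe S).symm
    _ = Module.finrank ℝ (S → ℝ) := (Module.finrank_fintype_fun_eq_card ℝ).symm
    _ = (Q * U).rank := by
        rw [Matrix.rank, LinearMap.finrank_range_of_inj hinj]
    _ ≤ Q.rank := Matrix.rank_mul_le_left _ _

/-- **Yabe 2015, Lemma 3.1 — DISCHARGE** (p0008: "Let `Q ∈ Mat_n(ℝ)`, `Q_sym := Q + Qᵀ`, and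
`(n₊, n₋, n₀)` be the signature of `Q_sym`. Then `rank(Q) ≥ max{n₊, n₋}`"; proof as printed: for
`u ≠ 0` in the span `V₊` of the positive eigenvectors `2uᵀQu = uᵀQ_sym u = Σ a_i² λ_i > 0`, so `Q` is
injective on `V₊` and `rank Q ≥ n₊`; likewise `n₋`). [cite: Yabe2015, Lemma 3.1] -/
theorem yabe2015_lemma_3_1_holds : yabe2015_lemma_3_1 := by
  intro n _ _ Q
  exact max_le
    (card_le_rank_of_eigenvalues_sign Q _ (Or.inl fun i hi => (Finset.mem_filter.1 hi).2))
    (card_le_rank_of_eigenvalues_sign Q _ (Or.inr fun i hi => (Finset.mem_filter.1 hi).2))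

end Lemma31Proof

/-! ### Thm. 2.1 and Cor. 2.2 discharged: `brank` = minimum Gram rank (val-lit t17) -/

section GramAPI

variable {K : Type u} [CommSemiring K] {σ : Type v} [Fintype σ] [DecidableEq σ] {k : ℕ}

/-- `v(x)ᵀ Q v(x)` is additive in `Q` (Yabe 2015, §2.1, p0005: the feasible region is an affine
subspace). [cite: Yabe2015, §2.1] -/
theorem gramPoly_add (Q₁ Q₂ : Matrix (DegIdx σ k) (DegIdx σ k) K) :
    gramPoly k (Q₁ + Q₂) = gramPoly k Q₁ + gramPoly k Q₂ := by
  simp only [gramPoly, Matrix.add_apply, map_add, Finset.sum_add_distrib]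

/-- `v(x)ᵀ Q v(x)` is homogeneous in `Q` (Yabe 2015, §2.1, p0005). [cite: Yabe2015, §2.1] -/
theorem gramPoly_smul (a : K) (Q : Matrix (DegIdx σ k) (DegIdx σ k) K) :
    gramPoly k (a • Q) = a • gramPoly k Q := by
  simp only [gramPoly, Matrix.smul_apply, smul_eq_mul, Finset.smul_sum, smul_monomial]

/-- `v(x)ᵀ Qᵀ v(x) = v(x)ᵀ Q v(x)` (Yabe 2015, proof of Cor. 2.2, p0005: `Q = (Q' + Q'ᵀ)/2` is feasible).
[cite: Yabe2015, Corollary 2.2 (proof)] -/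
theorem gramPoly_transpose (Q : Matrix (DegIdx σ k) (DegIdx σ k) K) :
    gramPoly k Qᵀ = gramPoly k Q := by
  simp only [gramPoly, Matrix.transpose_apply]
  rw [Finset.sum_comm]
  exact Finset.sum_congr rfl fun I _ => Finset.sum_congr rfl fun J _ => by rw [add_comm]

/-- `v(x)ᵀ Q v(x)` is homogeneous of degree `2k` (Yabe 2015, §2.1, p0005). [cite: Yabe2015, §2.1] -/
theorem isHomogeneous_gramPoly (Q : Matrix (DegIdx σ k) (DegIdx σ k) K) :
    (gramPoly k Q).IsHomogeneous (2 * k) := by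
  refine IsHomogeneous.sum _ _ _ fun I _ => IsHomogeneous.sum _ _ _ fun J _ => ?_
  refine isHomogeneous_monomial _ ?_
  rw [map_add, mem_degMonomials_iff.1 I.2, mem_degMonomials_iff.1 J.2]; ring

end GramAPI

section RankMinimisationProofs

variable {K : Type u} [Field K] {σ : Type v} [Fintype σ] [DecidableEq σ] {k : ℕ}

/-- Scaling does not increase the rank. [folklore] -/
private theorem rank_smul_le' {m n : Type*} [Fintype m] [Fintype n] [DecidableEq m] (c : K)
    (A : Matrix m n K) : (c • A).rank ≤ A.rank := by
  calc (c • A).rank = ((c • (1 : Matrix m m K)) * A).rank := by rw [Matrix.smul_mul, Matrix.one_mul]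
    _ ≤ A.rank := Matrix.rank_mul_le_right _ _

/-- Sub-additivity of the rank over a finite sum. [folklore] -/
private theorem rank_sum_le' {m n : Type*} [Fintype m] [Fintype n] {ι : Type*} (s : Finset ι)
    (A : ι → Matrix m n K) : (∑ i ∈ s, A i).rank ≤ ∑ i ∈ s, (A i).rank := by
  classical
  induction s using Finset.induction_on with
  | empty => simp
  | insert a s ha ih =>
      rw [Finset.sum_insert ha, Finset.sum_insert ha]
      exact (rank_add_le _ _).trans (Nat.add_le_add_left ih _)

/-- **Yabe 2015, Theorem 2.1, direction `brank(p) ≥ rank Q₀`** (p0005): a decomposition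
`p = Σ_{i ∈ ι} f_i g_i` into degree-`k` forms gives the Gram matrix `Q₀ = Σ_i f⃗_i g⃗_iᵀ` of `p`
(`f⃗ = formCoeff k f`, the coefficient vector), of rank `≤ |ι|`. [cite: Yabe2015, Theorem 2.1 (proof)] -/
theorem exists_gramPoly_eq_of_eq_sum {ι : Type*} [Fintype ι] {p : MvPolynomial σ K}
    (f g : ι → MvPolynomial σ K) (hf : ∀ i, (f i).IsHomogeneous k)
    (hg : ∀ i, (g i).IsHomogeneous k) (hp : p = ∑ i, f i * g i) :
    ∃ Q : Matrix (DegIdx σ k) (DegIdx σ k) K, gramPoly k Q = p ∧ Q.rank ≤ Fintype.card ι := by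
  classical
  refine ⟨∑ i, vecMulVec (formCoeff k (f i)) (formCoeff k (g i)), ?_, ?_⟩
  · have hfi : ∀ i, f i = ∑ I : DegIdx σ k, monomial I.1 (coeff I.1 (f i)) := fun i => by
      conv_lhs => rw [← sum_coeff_smul_monomial_eq (hf i)]
      exact Finset.sum_congr rfl fun I _ => by rw [smul_monomial, smul_eq_mul, mul_one]
    have hgi : ∀ i, g i = ∑ J : DegIdx σ k, monomial J.1 (coeff J.1 (g i)) := fun i => by
      conv_lhs => rw [← sum_coeff_smul_monomial_eq (hg i)]
      exact Finset.sum_congr rfl fun J _ => by rw [smul_monomial, smul_eq_mul, mul_one]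
    rw [hp]
    calc gramPoly k (∑ i, vecMulVec (formCoeff k (f i)) (formCoeff k (g i)))
        = ∑ I : DegIdx σ k, ∑ J : DegIdx σ k, ∑ i, monomial (I.1 + J.1)
            (coeff I.1 (f i) * coeff J.1 (g i)) := by
          unfold gramPoly
          refine Finset.sum_congr rfl fun I _ => Finset.sum_congr rfl fun J _ => ?_
          rw [Matrix.sum_apply, map_sum]
          rfl
      _ = ∑ I : DegIdx σ k, ∑ i, ∑ J : DegIdx σ k, monomial (I.1 + J.1)
            (coeff I.1 (f i) * coeff J.1 (g i)) :=
          Finset.sum_congr rfl fun I _ => Finset.sum_comm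
      _ = ∑ i, ∑ I : DegIdx σ k, ∑ J : DegIdx σ k, monomial (I.1 + J.1)
            (coeff I.1 (f i) * coeff J.1 (g i)) := Finset.sum_comm
      _ = ∑ i, f i * g i := by
          refine Finset.sum_congr rfl fun i _ => ?_
          conv_rhs => rw [hfi i, hgi i, Finset.sum_mul_sum]
          exact Finset.sum_congr rfl fun I _ => Finset.sum_congr rfl fun J _ => by
            rw [monomial_mul]
  · calc (∑ i, vecMulVec (formCoeff k (f i)) (formCoeff k (g i))).rank
        ≤ ∑ i, (vecMulVec (formCoeff k (f i)) (formCoeff k (g i))).rank := rank_sum_le' _ _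
      _ ≤ ∑ _i : ι, 1 := Finset.sum_le_sum fun i _ => Matrix.rank_vecMulVec_le _ _
      _ = Fintype.card ι := by simp

/-- **Yabe 2015, Theorem 2.1, direction `brank(p) ≤ rank Q`** (p0005): a Gram matrix `Q` of `p`
(`v(x)ᵀ Q v(x) = p`) is a sum of `rank Q` rank-one matrices `b_i c_iᵀ` (`b_i` a basis of the column
space), whence `p = Σ_{i < rank Q} (b_iᵀ v(x))(c_iᵀ v(x))`. [cite: Yabe2015, Theorem 2.1 (proof)] -/
theorem exists_eq_sum_of_gramPoly_eq {p : MvPolynomial σ K}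
    (Q : Matrix (DegIdx σ k) (DegIdx σ k) K) (hQ : gramPoly k Q = p) :
    ∃ f g : Fin Q.rank → MvPolynomial σ K, (∀ i, (f i).IsHomogeneous k) ∧
      (∀ i, (g i).IsHomogeneous k) ∧ p = ∑ i, f i * g i := by
  classical
  set W := LinearMap.range Q.mulVecLin with hW
  let b : Module.Basis (Fin Q.rank) K W := Module.finBasis K W
  have hcol : ∀ J : DegIdx σ k, (fun I => Q I J) ∈ W := fun J =>
    ⟨Pi.single J 1, by rw [Matrix.mulVecLin_apply, Matrix.mulVec_single_one]; rfl⟩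
  set c : Fin Q.rank → DegIdx σ k → K := fun i J => b.repr ⟨fun I => Q I J, hcol J⟩ i with hc
  have hQIJ : ∀ I J, Q I J = ∑ i, (b i : DegIdx σ k → K) I * c i J := by
    intro I J
    have h := b.sum_repr ⟨fun I => Q I J, hcol J⟩
    have h2 := congrArg (fun w : W => (w : DegIdx σ k → K) I) h
    simp only [Submodule.coe_sum, Submodule.coe_smul, Finset.sum_apply, Pi.smul_apply,
      smul_eq_mul] at h2
    rw [← h2]
    exact Finset.sum_congr rfl fun i _ => by rw [hc]; ring
  refine ⟨fun i => ∑ I : DegIdx σ k, monomial I.1 ((b i : DegIdx σ k → K) I),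
    fun i => ∑ J : DegIdx σ k, monomial J.1 (c i J),
    fun i => IsHomogeneous.sum _ _ _ fun I _ => isHomogeneous_monomial _ (mem_degMonomials_iff.1 I.2),
    fun i => IsHomogeneous.sum _ _ _ fun J _ => isHomogeneous_monomial _ (mem_degMonomials_iff.1 J.2),
    ?_⟩
  rw [← hQ]
  calc gramPoly k Q = ∑ I : DegIdx σ k, ∑ J : DegIdx σ k, ∑ i, monomial (I.1 + J.1)
          ((b i : DegIdx σ k → K) I * c i J) := by
        unfold gramPoly
        refine Finset.sum_congr rfl fun I _ => Finset.sum_congr rfl fun J _ => ?_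
        rw [hQIJ I J, map_sum]
    _ = ∑ I : DegIdx σ k, ∑ i, ∑ J : DegIdx σ k, monomial (I.1 + J.1)
          ((b i : DegIdx σ k → K) I * c i J) :=
        Finset.sum_congr rfl fun I _ => Finset.sum_comm
    _ = ∑ i, ∑ I : DegIdx σ k, ∑ J : DegIdx σ k, monomial (I.1 + J.1)
          ((b i : DegIdx σ k → K) I * c i J) := Finset.sum_comm
    _ = ∑ i, (∑ I : DegIdx σ k, monomial I.1 ((b i : DegIdx σ k → K) I)) *
          (∑ J : DegIdx σ k, monomial J.1 (c i J)) := by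
        refine Finset.sum_congr rfl fun i _ => ?_
        rw [Finset.sum_mul_sum]
        exact Finset.sum_congr rfl fun I _ => Finset.sum_congr rfl fun J _ => by rw [monomial_mul]

/-- **Discharge of `yabe2015_thm_2_1`** (Yabe 2015, Thm. 2.1, p0005): `brank(p)` equals the minimum
rank of a Gram matrix of `p`. Both infima range over sets that are simultaneously empty or not
(`exists_gramPoly_eq_of_eq_sum`, `exists_eq_sum_of_gramPoly_eq`), so the homogeneity hypothesis is not
even used. [cite: Yabe2015, Theorem 2.1] -/
theorem yabe2015_thm_2_1_holds : yabe2015_thm_2_1 := by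
  intro K _ σ _ _ k p _hp
  classical
  set Sg : Set ℕ := Matrix.rank '' {Q : Matrix (DegIdx σ k) (DegIdx σ k) K | gramPoly k Q = p}
  set Sb : Set ℕ := {n : ℕ | ∃ f g : Fin n → MvPolynomial σ K,
    (∀ i, (f i).IsHomogeneous k) ∧ (∀ i, (g i).IsHomogeneous k) ∧ p = ∑ i, f i * g i}
  change sInf Sb = sInf Sg
  apply le_antisymm
  · by_cases hg : Sg.Nonempty
    · obtain ⟨Q, hQp, hQr⟩ := Nat.sInf_mem hg
      obtain ⟨f, g, hf, hg', hp⟩ := exists_eq_sum_of_gramPoly_eq Q hQp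
      rw [← hQr]
      exact Nat.sInf_le ⟨f, g, hf, hg', hp⟩
    · rw [Set.not_nonempty_iff_eq_empty] at hg
      have hb : Sb = ∅ := by
        rw [Set.eq_empty_iff_forall_notMem]
        rintro n ⟨f, g, hf, hg', hp⟩
        obtain ⟨Q, hQ, -⟩ := exists_gramPoly_eq_of_eq_sum f g hf hg' hp
        have : Q.rank ∈ Sg := ⟨Q, hQ, rfl⟩
        rw [hg] at this
        exact this
      rw [hb, hg]
  · by_cases hb : Sb.Nonempty
    · obtain ⟨f, g, hf, hg', hp⟩ := Nat.sInf_mem hb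
      obtain ⟨Q, hQ, hQr⟩ := exists_gramPoly_eq_of_eq_sum f g hf hg' hp
      rw [Fintype.card_fin] at hQr
      have hmem : Q.rank ∈ Sg := ⟨Q, hQ, rfl⟩
      exact (Nat.sInf_le hmem).trans hQr
    · rw [Set.not_nonempty_iff_eq_empty] at hb
      have hg : Sg = ∅ := by
        rw [Set.eq_empty_iff_forall_notMem]
        rintro n ⟨Q, hQ, rfl⟩
        obtain ⟨f, g, hf, hg', hp⟩ := exists_eq_sum_of_gramPoly_eq Q hQ
        have : Q.rank ∈ Sb := ⟨f, g, hf, hg', hp⟩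
        rw [hb] at this
        exact this
      rw [hb, hg]

/-- **Discharge of `yabe2015_cor_2_2`** (Yabe 2015, Cor. 2.2, p0005): symmetrise an optimal Gram
matrix, `Q = ½(Q' + Q'ᵀ)`; it is again a Gram matrix of `p` (`gramPoly_transpose`) and
`rank Q ≤ rank Q' + rank Q'ᵀ = 2·brank(p)` (Thm. 2.1). [cite: Yabe2015, Corollary 2.2] -/
theorem yabe2015_cor_2_2_holds : yabe2015_cor_2_2 := by
  intro σ _ _ k p hp
  have h21 := yabe2015_thm_2_1_holds ℝ σ k p hp
  by_cases hne : ({Q : Matrix (DegIdx σ k) (DegIdx σ k) ℝ | gramPoly k Q = p}).Nonempty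
  · obtain ⟨Q', hQ'p, hQ'r⟩ := Nat.sInf_mem (hne.image Matrix.rank)
    change gramPoly k Q' = p at hQ'p
    set Q : Matrix (DegIdx σ k) (DegIdx σ k) ℝ := (1 / 2 : ℝ) • (Q' + Q'ᵀ) with hQ
    have hQsym : Q.IsSymm := by
      rw [Matrix.IsSymm, hQ, Matrix.transpose_smul, Matrix.transpose_add, Matrix.transpose_transpose,
        add_comm]
    have hQp : gramPoly k Q = p := by
      rw [hQ, gramPoly_smul, gramPoly_add, gramPoly_transpose, hQ'p, ← two_smul ℝ p, smul_smul]
      norm_num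
    calc sInf (Matrix.rank '' {Q : Matrix (DegIdx σ k) (DegIdx σ k) ℝ | Q.IsSymm ∧ gramPoly k Q = p})
        ≤ Q.rank := Nat.sInf_le ⟨Q, ⟨hQsym, hQp⟩, rfl⟩
      _ ≤ (Q' + Q'ᵀ).rank := rank_smul_le' _ _
      _ ≤ Q'.rank + Q'ᵀ.rank := rank_add_le _ _
      _ = 2 * bRank k p := by rw [Matrix.rank_transpose, hQ'r, ← h21]; ring
  · have h0 : {Q : Matrix (DegIdx σ k) (DegIdx σ k) ℝ | Q.IsSymm ∧ gramPoly k Q = p} = ∅ := by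
      rw [Set.eq_empty_iff_forall_notMem]
      intro Q hQ
      exact hne ⟨Q, hQ.2⟩
    rw [h0, Set.image_empty, Nat.sInf_empty]
    exact Nat.zero_le _

end RankMinimisationProofs

/-! ### The signature engine of §3.2 (proved): `max(n₊, n₋)(H_{p,x₀}) ≤ dc(p)` over `ℝ` (val-lit t17) -/

section SignatureEngine

/-- Core count: if the kernel of a linear map `Ψ : ℝ^σ → ℝ^m` is isotropic for the real symmetric
`H` (`zᵀHz = 0` whenever `Ψ z = 0`), then the eigenvalues of `H` of one strict sign (`ε = ±1`)
number at most `|m|`: the images `Ψ u_i` of the corresponding orthonormal eigenvectors are linearly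
independent (Yabe 2015, Lemma 3.1, proof pattern, p0008). [cite: Yabe2015, Lemma 3.1 (proof)] -/
private theorem card_le_of_isotropic_ker {σ : Type*} [Fintype σ] [DecidableEq σ]
    {m : Type*} [Fintype m]
    {H : Matrix σ σ ℝ} (hH : H.IsHermitian) (Ψ : (σ → ℝ) →ₗ[ℝ] (m → ℝ))
    (hiso : ∀ z, Ψ z = 0 → z ⬝ᵥ H *ᵥ z = 0) (P : Finset σ) (ε : ℝ)
    (hP : ∀ i ∈ P, 0 < ε * hH.eigenvalues i) : P.card ≤ Fintype.card m := by
  set u : σ → σ → ℝ := fun i => (hH.eigenvectorBasis i).ofLp with hu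
  have horth : ∀ i j, u i ⬝ᵥ u j = if i = j then 1 else 0 := fun i j =>
    Literature.Analysis.Matrix.KyFan.eigenvectorBasis_dotProduct hH i j
  have hli : LinearIndependent ℝ (fun i : P => Ψ (u i.1)) := by
    rw [Fintype.linearIndependent_iff]
    intro g hg
    set v : σ → ℝ := ∑ i : P, g i • u i.1 with hv
    have hΨv : Ψ v = 0 := by
      rw [hv, map_sum]
      simpa [map_smul] using hg
    have hcoord : ∀ j : σ, u j ⬝ᵥ v = if h : j ∈ P then g ⟨j, h⟩ else 0 := by
      intro j
      rw [hv, dotProduct_sum]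
      simp_rw [dotProduct_smul, smul_eq_mul, horth]
      by_cases hj : j ∈ P
      · rw [dif_pos hj, Finset.sum_eq_single ⟨j, hj⟩]
        · simp
        · intro i _ hi
          have : j ≠ i.1 := fun h => hi (Subtype.ext h.symm)
          simp [this]
        · simp
      · rw [dif_neg hj]
        refine Finset.sum_eq_zero fun i _ => ?_
        have : j ≠ i.1 := fun h => hj (h ▸ i.2)
        simp [this]
    have hS0 := hiso v hΨv
    rw [Literature.Analysis.Matrix.KyFan.dotProduct_mulVec_eq_sum_eigen hH v] at hS0
    have hsum : ∑ j, ε * (hH.eigenvalues j * (u j ⬝ᵥ v) ^ 2) = 0 := by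
      rw [← Finset.mul_sum]
      change ε * ∑ j, hH.eigenvalues j * ((hH.eigenvectorBasis j).ofLp ⬝ᵥ v) ^ 2 = 0
      rw [hS0, mul_zero]
    have hnonneg : ∀ j ∈ (Finset.univ : Finset σ),
        0 ≤ ε * (hH.eigenvalues j * (u j ⬝ᵥ v) ^ 2) := by
      intro j _
      by_cases hj : j ∈ P
      · rw [← mul_assoc]
        exact mul_nonneg (hP j hj).le (sq_nonneg _)
      · rw [hcoord j, dif_neg hj]; simp
    have hterm := (Finset.sum_eq_zero_iff_of_nonneg hnonneg).1 hsum
    intro i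
    have hi := hterm i.1 (Finset.mem_univ _)
    rw [hcoord i.1, dif_pos i.2, ← mul_assoc] at hi
    rcases mul_eq_zero.1 hi with h0 | h0
    · exact absurd h0 (ne_of_gt (hP i.1 i.2))
    · simpa using h0
  have h := hli.fintype_card_le_finrank
  rwa [Fintype.card_coe, Module.finrank_fintype_fun_eq_card] at h

/-- The Hessian matrix of a real polynomial is symmetric, `h_{(i,j),(i',j')} = h_{(i',j'),(i,j)}`
(Yabe 2015, §3.2, p0008), i.e. Hermitian over `ℝ`, so Mathlib's spectrum
`Matrix.IsHermitian.eigenvalues` applies. [cite: Yabe2015, §3.2] -/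
theorem isHermitian_hessianMatrix {σ : Type*} (f : MvPolynomial σ ℝ) (x : σ → ℝ) :
    (hessianMatrix f x).IsHermitian := by
  rw [Matrix.IsHermitian, conjTranspose_eq_transpose_of_trivial, hessianMatrix_transpose]

/-- **Signature form of the determinantal step** (Yabe 2015, §3.2, proof of Thm. 1.7, p0008–p0009:
"`dc(perm_d) ≥ brank(perm^{(2)}_{d,Σ_d}) = rank(Q_opt) ≥ n₋`", every link of which — Thm. 1.5 with
`k = 1`, Thm. 2.1, Lemma 3.1 — is general). If `f = det A` with `A` an `|m| × |m|` matrix of real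
affine linear forms and `f(x) = 0`, then the numbers `n₊, n₋` of positive and of negative eigenvalues
of the Hessian `H_{f,x}` are each `≤ |m|`. PROVED here directly (not via `brank`): by the tree's
Mignon–Ressayre lemma `dotProduct_hessianMatrix_detPoly_mulVec_eq_zero`, `H_{det,Y}` (`Y = A(x)`
singular, `w Y = 0`) vanishes on the subspace `{Z | wZ = 0}`, so by the affine chain rule
(`hessianMatrix_aeval_of_affine`) `H_{f,x}` vanishes on the kernel of `z ↦ w·(Lz)`, a map to `ℝ^m`;
a definite subspace meets an isotropic one trivially (`card_le_of_isotropic_ker`).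
[cite: Yabe2015, §3.2 (proof of Theorem 1.7)] -/
theorem card_eigenvalues_hessian_le_of_isAffineDetRepr {σ : Type*} [Fintype σ] [DecidableEq σ]
    {f : MvPolynomial σ ℝ} {m : Type*} [Fintype m] [DecidableEq m]
    {A : Matrix m m (MvPolynomial σ ℝ)} (hA : IsAffineDetRepr f A) (x : σ → ℝ)
    (hx : eval x f = 0) (hH : (hessianMatrix f x).IsHermitian) :
    (Finset.univ.filter fun i => 0 < hH.eigenvalues i).card ≤ Fintype.card m ∧
      (Finset.univ.filter fun i => hH.eigenvalues i < 0).card ≤ Fintype.card m := by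
  obtain ⟨hdeg, hdet⟩ := hA
  have hf : f = aeval (fun p : m × m => A p.1 p.2) (detPoly m ℝ) := by
    rw [detPoly, AlgHom.map_det, mvPolynomialX_mapMatrix_aeval ℝ A, hdet]
  have hφ : ∀ (t : m × m) (u v : σ), pderiv u (pderiv v (A t.1 t.2)) = 0 := fun t u v =>
    pderiv_pderiv_eq_zero_of_totalDegree_le_one (hdeg t.1 t.2) u v
  set L : Matrix (m × m) σ ℝ := Matrix.of fun t v => eval x (pderiv v (A t.1 t.2)) with hL
  set Y : Matrix m m ℝ := Matrix.of fun i j => eval x (A i j) with hYdef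
  set Hdet : Matrix (m × m) (m × m) ℝ := hessianMatrix (detPoly m ℝ) fun p => Y p.1 p.2 with hHdet
  have hHeq : hessianMatrix f x = Lᵀ * Hdet * L := by
    conv_lhs => rw [hf]
    rw [hessianMatrix_aeval_of_affine _ hφ]
    rfl
  have hYdet : Y.det = 0 := by
    have hmap : (MvPolynomial.eval x).mapMatrix A = Y := by
      ext i j; rfl
    rw [← hmap, ← RingHom.map_det, hdet, hx]
  obtain ⟨w, hw, hwY⟩ := Matrix.exists_vecMul_eq_zero_iff.mpr hYdet
  set P : Matrix m (m × m) ℝ := Matrix.of fun j q => if q.2 = j then w q.1 else 0 with hP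
  have hPZ : ∀ Z : m × m → ℝ, P *ᵥ Z = w ᵥ* (Matrix.of fun i j => Z (i, j)) := by
    intro Z
    ext j
    simp only [hP, mulVec, dotProduct, of_apply, vecMul, ite_mul, zero_mul]
    rw [Fintype.sum_prod_type]
    simp only [Finset.sum_ite_eq', Finset.mem_univ, if_true]
  have hiso : ∀ z : σ → ℝ, (P * L).mulVecLin z = 0 → z ⬝ᵥ hessianMatrix f x *ᵥ z = 0 := by
    intro z hz
    rw [Matrix.mulVecLin_apply, ← mulVec_mulVec, hPZ] at hz
    rw [hHeq, ← mulVec_mulVec, ← mulVec_mulVec, dotProduct_mulVec, vecMul_transpose]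
    exact dotProduct_hessianMatrix_detPoly_mulVec_eq_zero Y (Matrix.of fun i j => (L *ᵥ z) (i, j))
      (Matrix.of fun i j => (L *ᵥ z) (i, j)) w hw hwY hz hz
  exact ⟨card_le_of_isotropic_ker hH _ hiso _ 1 fun i hi => by
      simpa using (Finset.mem_filter.1 hi).2,
    card_le_of_isotropic_ker hH _ hiso _ (-1) fun i hi => by
      have := (Finset.mem_filter.1 hi).2; linarith⟩

/-- **Yabe's signature bound for the determinantal complexity** (Yabe 2015, §3.2, p0008–p0009, the
chain `dc(p) ≥ brank(p_{x₀}^{(2)}) ≥ rank Q_opt ≥ max(n₊, n₋)` of Thm. 1.5 (`k = 1`), Thm. 2.1 and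
Lemma 3.1, stated there for `perm_d` at `Σ_d`): over `ℝ`, at every zero `x₀` of `p`,
`max(n₊, n₋)(H_{p,x₀}) ≤ dc(p)`, where `(n₊, n₋, n₀)` is the signature of the Hessian. With the
signature `(2d−2, (d−1)²+1, 0)` of `H_{per_d,Σ_d}` this is exactly how the source derives Thm. 1.7;
that signature computation is the part NOT yet in tree (see `yabe2015_thm_1_7`). Sharper over `ℝ`
than the rank form `rank H ≤ 2·dc` (`rank_hessianMatrix_le_two_mul_determinantalComplexity`).
PROVED (`card_eigenvalues_hessian_le_of_isAffineDetRepr` at the attained representation,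
`hasDetRepr_determinantalComplexity_holds`). [cite: Yabe2015, §3.2 (proof of Theorem 1.7)] -/
theorem yabe2015_signature_le_determinantalComplexity {σ : Type*} [Fintype σ] [DecidableEq σ]
    (p : MvPolynomial σ ℝ) (x₀ : σ → ℝ) (hx : eval x₀ p = 0)
    (hH : (hessianMatrix p x₀).IsHermitian) :
    max (Finset.univ.filter fun i => 0 < hH.eigenvalues i).card
        (Finset.univ.filter fun i => hH.eigenvalues i < 0).card ≤ determinantalComplexity p := by
  obtain ⟨A, hA⟩ := hasDetRepr_determinantalComplexity_holds p
  have h := card_eigenvalues_hessian_le_of_isAffineDetRepr hA x₀ hx hH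
  rw [Fintype.card_fin] at h
  exact max_le h.1 h.2

end SignatureEngine

end Literature.Computability.AlgebraicComplexity
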